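/-
# PeepholeVorticityDoorCoreDefs — door S29 «PeepholeVorticityDoor», FILE 2 («Core», stub 1 `PeepholeToCore`):
# the quantities, the six stub TEXTS and the kernel-checked composition `peepholeToCore_of_stubs`
# (nsreg-p1 g23 `r27/Skeleton29.lean` a83afe48495060f1 = FILE-2 CARVE 691b0f1a3d97ebcd, the plan of record DIRECTOR-NS #131;
# refuter1 g9 K-62 PASS; theorems-side landing by ns-s29-p2 g2 per #135 (b) + refuter1 K-65 «ONE §0 file … every plate imports it»).

TARGET of FILE 2 = the existential `PeepholeToCore` (`PeepholeVorticityDoorDefs` §2), the door's only open hypothesis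
(`targetPeepholeVorticity_of_peepholeToCore`, `PeepholeVorticityDoorFrame`).  The explicit §2b form `PeepholeToCoreExplicit`
is REFUTED as typed (`PeepholeVorticityDoor/Negative/ExplicitFalseAsTyped.lean`, S29 ERRATUM 1 E1) and is off the critical path.

DESIGN (CARVE §0): Tao 2021 Prop. 4.3 — tree `TaoCarleman.second_carleman_inequality_of_ball` — applied AT PHYSICAL SCALE.
With `ℓ = √(−t̄)`, `T' = T_c ℓ²`, centre `x₀ = ℓ y₀`, Carleman radius `r = r_T ℓ`, `t₀ = τ ℓ²` (`τ = T_c/8000`), `t₁ = t₀ e^(−S)`,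
the (5.5)-type hypothesis `|u| ≤ T'^(−1/2)`, `|∇u| ≤ T'⁻¹` on `[t̄ − T', t̄] × B̄(x₀, r)` follows from (1.15) (`C_u ≤ T_c^(−1/2)`) and
the gradient bound (`K ≤ T_c⁻¹`) because `√(−t) ≥ ℓ` below the slice; Tao's window `s ∈ [t₀, 2t₀]` IS the door's window
`t' = t̄ − s ∈ [(1+2τ)t̄, (1+τ)t̄]`; every `ℓ` cancels in the bookkeeping (Stub B3 is scale-free).  NO rescaling of the solution.

* §1 quantities: `vB`, `t1S29pkg`, `cLHS`, `cX`, `cY` (Tao's three integrals at `finrank = 3`), `Jcore`.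
* §2 the six stub TEXTS (`def … : Prop`), each closed by its own Theorems file (`…_holds`):
  Stub A `RegionCarlemanVorticityS29` (REGION twin of tree `IsClassicalNSSolutionOn.second_carleman_vorticity`),
  Stub B1 `CoreLowerS29`, Stub B2 `UpperXYS29`, Stub B3 `CarlemanBudgetS29` (scalar, existential, scale-free),
  Stub D `CylinderPackageS29` (cylinder package at lateness `t1S29pkg ≤ 1/2`, honouring E1), Stub B4 `ChebyshevPullbackS29`.
* §3 `peepholeToCore_of_stubs : A → B1 → B2 → B3 → D → B4 → PeepholeToCore` — plumbing only, PROVED (the six texts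
  enter as hypotheses, exactly as `targetPeepholeVorticity_of_peepholeToCore` takes `PeepholeToCore`).

WHAT THIS IS NOT: not NS regularity (Clay (A)); not a dent in `NoTypeII` (stmt-0056 stays OPEN); no stub is proved here —
texts + composition for a HYPOTHETICAL-blow-up door.  [cite: Tao 2021 (arXiv:1908.04958v2) Prop. 4.3, Thm. 5.1 proof p. 37]
-/
import Summits.NavierStokesRegularity.NavierStokesRegularity.Theorems.PeepholeVorticityDoorDefs

noncomputable section

set_option linter.dupNamespace false

namespace Summit.NavierStokesRegularity.NavierStokesRegularity.Theorems.PeepholeVorticityDoor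

open MeasureTheory Set Function Filter Topology TopologicalSpace Metric
open scoped RealInnerProductSpace NNReal ENNReal Topology
open Literature.Analysis Literature.Analysis.FluidPDE

/-! ## §1 Quantities (generic in a backward field `U : ℝ → ℝ³ → ℝ³`, `U s y`; for the door `U s y = ω(t̄ − s, x₀ + y)`) -/

/-- `|B(0,1)| ⊂ ℝ³` as a real number (`= 4π/3`; only the scaling `Measure.addHaar_ball_of_pos` is ever used). -/
def vB : ℝ := (volume (ball (0 : EuclideanSpace ℝ (Fin 3)) 1)).toReal

/-- lateness making the Carleman cylinder fit: inside the gradient region, inside `B(0,1/2)`, and `t̄ > −1/2`. -/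
def t1S29pkg (c₁ d R rT : ℝ) : ℝ := min (1 / 2) ((min c₁ 1) ^ 2 / (4 * (d + 3 * R + rT + 4) ^ 2))

/-- Tao's Carleman left-hand side `∫_(t₀)^(2t₀) ∫_(B(0,r/2)) (T'⁻¹|U|² + |∇U|²) e^(−|y|²/4s)`. -/
def cLHS (U : ℝ → EuclideanSpace ℝ (Fin 3) → EuclideanSpace ℝ (Fin 3)) (Tp r t₀ : ℝ) : ℝ :=
  ∫ s in t₀..2 * t₀, ∫ y in ball (0 : EuclideanSpace ℝ (Fin 3)) (r / 2),
    (Tp⁻¹ * ‖U s y‖ ^ 2 + ‖fderiv ℝ (U s) y‖ ^ 2) * Real.exp (-‖y‖ ^ 2 / (4 * s))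

/-- Tao's `X = ∫₀^(T') ∫_(B(0,r)) (T'⁻¹|U|² + |∇U|²)`. -/
def cX (U : ℝ → EuclideanSpace ℝ (Fin 3) → EuclideanSpace ℝ (Fin 3)) (Tp r : ℝ) : ℝ :=
  ∫ s in (0 : ℝ)..Tp, ∫ y in ball (0 : EuclideanSpace ℝ (Fin 3)) r, (Tp⁻¹ * ‖U s y‖ ^ 2 + ‖fderiv ℝ (U s) y‖ ^ 2)

/-- Tao's `Y = ∫_(B(0,r)) |U(0,y)|² t₁^(−3/2) e^(−|y|²/4t₁)`. -/
def cY (U : ℝ → EuclideanSpace ℝ (Fin 3) → EuclideanSpace ℝ (Fin 3)) (r t₁ : ℝ) : ℝ :=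
  ∫ y in ball (0 : EuclideanSpace ℝ (Fin 3)) r, ‖U 0 y‖ ^ 2 * (t₁ ^ (-(3 : ℝ) / 2) * Real.exp (-‖y‖ ^ 2 / (4 * t₁)))

/-- the core integral `J = ∫_(t₀)^(2t₀) ∫_(B(0, ρ)) |V(s, x)|² dx ds` (physical space variable, FIXED radius; for the door
`V s x = ω(t̄ − s, x)`, `ρ = 3Rℓ ≥ 2R√(−t')` for every `t'` in the window). -/
def Jcore (V : ℝ → EuclideanSpace ℝ (Fin 3) → EuclideanSpace ℝ (Fin 3)) (ρ t₀ : ℝ) : ℝ :=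
  ∫ s in t₀..2 * t₀, ∫ x in ball (0 : EuclideanSpace ℝ (Fin 3)) ρ, ‖V s x‖ ^ 2

/-! ## §2 The six stub TEXTS (statements only; each is closed by its own Theorems file as `…_holds`) -/

/-- **Stub A (L)** — Tao 2021 Prop. 4.3 for the backward translated vorticity of a REGION solution on `[−1,0) × B₁`
(`C²` of `U` on `[0,T'] × B(0,ρ)` from `smooth_velocity`; (4.4) with `C₀ = 1` from the vorticity equation and (5.5)). -/
def RegionCarlemanVorticityS29 : Prop :=
  ∃ Kt : ℝ, 0 < Kt ∧ ∀ ⦃tb Tp : ℝ⦄ ⦃u : ℝ → EuclideanSpace ℝ (Fin 3) → EuclideanSpace ℝ (Fin 3)⦄ ⦃p : ℝ → EuclideanSpace ℝ (Fin 3) → ℝ⦄,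
    IsClassicalNSSolutionOnRegion (Ico (-1 : ℝ) 0 ×ˢ ball (0 : EuclideanSpace ℝ (Fin 3)) 1) 1 0 u p →
    0 < Tp → -1 < tb - Tp → tb < 0 →
    ∀ (x₀ : EuclideanSpace ℝ (Fin 3)) ⦃r ρ t₀ t₁ : ℝ⦄, 0 < r → r < ρ → closedBall x₀ ρ ⊆ ball (0 : EuclideanSpace ℝ (Fin 3)) (1 / 2) →
    4000 * Tp ≤ r ^ 2 → 0 < t₁ → t₁ ≤ t₀ → 8000 * t₀ ≤ Tp →
    (∀ t ∈ Icc (tb - Tp) tb, ∀ x ∈ closedBall x₀ r, ‖u t x‖ ≤ (Real.sqrt Tp)⁻¹ ∧ ‖fderiv ℝ (u t) x‖ ≤ Tp⁻¹) →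
    cLHS (fun s y => curl (u (tb - s)) (x₀ + y)) Tp r t₀ ≤
      Kt * (Real.exp (-r ^ 2 / (500 * t₀)) * cX (fun s y => curl (u (tb - s)) (x₀ + y)) Tp r +
        t₀ ^ ((3 : ℝ) / 2) * Real.exp (Kt * (r ^ 2 / t₀) * Real.log (Real.exp 1 * t₀ / t₁)) *
          cY (fun s y => curl (u (tb - s)) (x₀ + y)) r t₁)

/-- **Stub B1 (L)** — generic: the Carleman left-hand side of `U(s,y) = V(s, x₀ + y)` dominates `T'⁻¹ e^(−W) · Jcore V ρ t₀`
(drop `|∇U|²`, translate `y = x − x₀`, bound the Gaussian weight below by `e^(−W)` on the ball `B(0, ρ) ⊆ B(x₀, r/2)`). -/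
def CoreLowerS29 : Prop :=
  ∀ (V : ℝ → EuclideanSpace ℝ (Fin 3) → EuclideanSpace ℝ (Fin 3)) (x₀ : EuclideanSpace ℝ (Fin 3)) (ρ Tp r t₀ W : ℝ),
    0 < Tp → 0 < t₀ → 2 * t₀ ≤ Tp →
    ContinuousOn (uncurry fun s y => V s (x₀ + y)) (Icc 0 Tp ×ˢ closedBall (0 : EuclideanSpace ℝ (Fin 3)) r) →
    ContinuousOn (fun z : ℝ × EuclideanSpace ℝ (Fin 3) => fderiv ℝ (fun y => V z.1 (x₀ + y)) z.2) (Icc 0 Tp ×ˢ closedBall (0 : EuclideanSpace ℝ (Fin 3)) r) →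
    ball (0 : EuclideanSpace ℝ (Fin 3)) ρ ⊆ ball x₀ (r / 2) →
    (∀ s ∈ Icc t₀ (2 * t₀), ∀ x ∈ ball (0 : EuclideanSpace ℝ (Fin 3)) ρ, ‖x - x₀‖ ^ 2 / (4 * s) ≤ W) →
    Tp⁻¹ * Real.exp (-W) * Jcore V ρ t₀ ≤ cLHS (fun s y => V s (x₀ + y)) Tp r t₀

/-- **Stub B2 (L)** — generic upper bounds for Tao's `X` and `Y` from sup bounds on the cylinder and an `ε'`-bound at `s = 0`
on `B(0, r_p')` (`∫ t₁^(−3/2) e^(−|y|²/4t₁) dy ≤ (4π)^(3/2)`; `|B_r| = vB · r³`). -/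
def UpperXYS29 : Prop :=
  ∀ (U : ℝ → EuclideanSpace ℝ (Fin 3) → EuclideanSpace ℝ (Fin 3)) (Tp r t₁ M₁ M₂ ε' rp' : ℝ),
    0 < Tp → 0 < r → 0 < t₁ → 0 ≤ M₁ → 0 ≤ M₂ → 0 ≤ ε' → 0 < rp' →
    ContinuousOn (uncurry U) (Icc 0 Tp ×ˢ closedBall (0 : EuclideanSpace ℝ (Fin 3)) r) →
    ContinuousOn (fun z : ℝ × EuclideanSpace ℝ (Fin 3) => fderiv ℝ (U z.1) z.2) (Icc 0 Tp ×ˢ closedBall (0 : EuclideanSpace ℝ (Fin 3)) r) →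
    (∀ s ∈ Icc 0 Tp, ∀ y ∈ closedBall (0 : EuclideanSpace ℝ (Fin 3)) r, ‖U s y‖ ≤ M₁ ∧ ‖fderiv ℝ (U s) y‖ ≤ M₂) →
    (∀ y ∈ ball (0 : EuclideanSpace ℝ (Fin 3)) rp', ‖U 0 y‖ ≤ ε') →
    cX U Tp r ≤ Tp * (vB * r ^ 3) * (Tp⁻¹ * M₁ ^ 2 + M₂ ^ 2) ∧
    cY U r t₁ ≤ ε' ^ 2 * (4 * Real.pi) ^ ((3 : ℝ) / 2) + M₁ ^ 2 * (vB * r ^ 3) * (t₁ ^ (-(3 : ℝ) / 2) * Real.exp (-rp' ^ 2 / (4 * t₁)))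

/-- **Stub B3 (L)** — the scalar Carleman budget, existential and scale-free: for Tao's `Kt`, any height fraction `Tc > 0`, lag
`τ > 0` and the data there are a Carleman radius `r_T`, a Gaussian scale drop `S ≥ 0` and a threshold `ε > 0` such that at every
slice `t̄ < 0` the budget is `≤ t₀ θ²/(5ℓ)` (`ℓ = √(−t̄)`; both sides are `ℓ ×` an `ℓ`-free quantity: divide by `ℓ` first).  Pure
real analysis (choose `r_T`, then `S`, then `ε`); (T) instantiates `Tc := tcS29 Cu K`, `τ := tauS29 Cu K`, `d := |y₀|`. -/
def CarlemanBudgetS29 : Prop :=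
  ∀ Kt : ℝ, 0 < Kt → ∀ (Tc τ θ R K K₂ d rp : ℝ), 0 < Tc → 0 < τ → 0 < θ → 2 ≤ R → 0 < K → 0 < K₂ → 0 ≤ d → 0 < rp →
    ∃ rT S ε : ℝ, 2 * (d + 3 * R) + 2 ≤ rT ∧ 4000 * Tc ≤ rT ^ 2 ∧ 0 ≤ S ∧ 0 < ε ∧
      ∀ tb : ℝ, tb < 0 →
        (Tc * (-tb)) * Real.exp ((d + 3 * R) ^ 2 / (4 * τ)) *
          (Kt * (Real.exp (-(rT * Real.sqrt (-tb)) ^ 2 / (500 * (τ * (-tb)))) * ((Tc * (-tb)) * (vB * (rT * Real.sqrt (-tb)) ^ 3) * ((Tc * (-tb))⁻¹ * (6 * K / (-tb)) ^ 2 + (6 * K₂ / ((-tb) * Real.sqrt (-tb))) ^ 2)) + (τ * (-tb)) ^ ((3 : ℝ) / 2) * Real.exp (Kt * ((rT * Real.sqrt (-tb)) ^ 2 / (τ * (-tb))) * Real.log (Real.exp 1 * (τ * (-tb)) / (τ * (-tb) * Real.exp (-S)))) * ((ε / (-tb)) ^ 2 * (4 * Real.pi) ^ ((3 : ℝ) /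 2) + (6 * K / (-tb)) ^ 2 * (vB * (rT * Real.sqrt (-tb)) ^ 3) * ((τ * (-tb) * Real.exp (-S)) ^ (-(3 : ℝ) / 2) * Real.exp (-(rp * Real.sqrt (-tb)) ^ 2 / (4 * (τ * (-tb) * Real.exp (-S))))))))
          ≤ (τ * (-tb)) * (θ ^ 2 / (5 * Real.sqrt (-tb)))

/-- **Stub D (T)** — the cylinder package at the slice `t̄ ∈ (−T₁, 0)`, `T₁ = t1S29pkg c₁ |y₀| R r_T`, `D_c = |y₀| + 3R`, stated in the shapes the generic
stubs consume (`U s y = ω(t̄ − s, ℓy₀ + y)`; note `u (t̄ − 0)` in (vii), matching `U 0`). -/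
def CylinderPackageS29 : Prop :=
  ∀ (Cu R K K₂ : ℝ) (y₀ : EuclideanSpace ℝ (Fin 3)) (rp c₁ rT ε : ℝ), 0 < Cu → 2 ≤ R → 0 < K → 0 < K₂ → 0 < rp → 0 < c₁ →
    2 * (‖y₀‖ + 3 * R) + 2 ≤ rT → 0 ≤ ε →
    ∀ (u : ℝ → EuclideanSpace ℝ (Fin 3) → EuclideanSpace ℝ (Fin 3)) (p : ℝ → EuclideanSpace ℝ (Fin 3) → ℝ),
      IsClassicalNSSolutionOnRegion (Ico (-1 : ℝ) 0 ×ˢ ball (0 : EuclideanSpace ℝ (Fin 3)) 1) 1 0 u p →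
      (∀ t ∈ Ico (-1 : ℝ) 0, ∀ x ∈ ball (0 : EuclideanSpace ℝ (Fin 3)) 1, ‖u t x‖ ≤ Cu / (Real.sqrt (-t) + ‖x‖)) →
      (∀ t ∈ Ioo (-1 : ℝ) 0, ∀ x : EuclideanSpace ℝ (Fin 3), ‖x‖ + Real.sqrt (-t) ≤ c₁ →
        ‖fderiv ℝ (u t) x‖ ≤ K / (‖x‖ + Real.sqrt (-t)) ^ 2) →
      (∀ t ∈ Ioo (-1 : ℝ) 0, ∀ x : EuclideanSpace ℝ (Fin 3), ‖x‖ + Real.sqrt (-t) ≤ c₁ →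
        ‖iteratedFDeriv ℝ 2 (u t) x‖ ≤ K₂ / (‖x‖ + Real.sqrt (-t)) ^ 3) →
      ∀ tb ∈ Ioo (-(t1S29pkg c₁ ‖y₀‖ R rT)) 0,
        (∀ x ∈ ball (Real.sqrt (-tb) • y₀) (Real.sqrt (-tb) * rp), (-tb) * ‖curl (u tb) x‖ ≤ ε) →
        (-1 < tb - (tcS29 Cu K * (-tb))) ∧
        (closedBall (Real.sqrt (-tb) • y₀) ((rT * Real.sqrt (-tb)) + Real.sqrt (-tb)) ⊆ ball (0 : EuclideanSpace ℝ (Fin 3)) (1 / 2)) ∧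
        (∀ t ∈ Icc (tb - (tcS29 Cu K * (-tb))) tb, ∀ x ∈ closedBall (Real.sqrt (-tb) • y₀) (rT * Real.sqrt (-tb)),
            ‖u t x‖ ≤ (Real.sqrt (tcS29 Cu K * (-tb)))⁻¹ ∧ ‖fderiv ℝ (u t) x‖ ≤ (tcS29 Cu K * (-tb))⁻¹) ∧
        ContinuousOn (uncurry fun s y => curl (u (tb - s)) ((Real.sqrt (-tb) • y₀) + y))
          (Icc 0 (tcS29 Cu K * (-tb)) ×ˢ closedBall (0 : EuclideanSpace ℝ (Fin 3)) (rT * Real.sqrt (-tb))) ∧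
        ContinuousOn (fun z : ℝ × EuclideanSpace ℝ (Fin 3) => fderiv ℝ (fun y => curl (u (tb - z.1)) ((Real.sqrt (-tb) • y₀) + y)) z.2)
          (Icc 0 (tcS29 Cu K * (-tb)) ×ˢ closedBall (0 : EuclideanSpace ℝ (Fin 3)) (rT * Real.sqrt (-tb))) ∧
        (∀ s ∈ Icc 0 (tcS29 Cu K * (-tb)), ∀ y ∈ closedBall (0 : EuclideanSpace ℝ (Fin 3)) (rT * Real.sqrt (-tb)),
            ‖curl (u (tb - s)) ((Real.sqrt (-tb) • y₀) + y)‖ ≤ (6 * K / (-tb)) ∧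
            ‖fderiv ℝ (fun y => curl (u (tb - s)) ((Real.sqrt (-tb) • y₀) + y)) y‖ ≤ (6 * K₂ / ((-tb) * Real.sqrt (-tb)))) ∧
        (∀ y ∈ ball (0 : EuclideanSpace ℝ (Fin 3)) (rp * Real.sqrt (-tb)), ‖curl (u (tb - 0)) ((Real.sqrt (-tb) • y₀) + y)‖ ≤ (ε / (-tb))) ∧
        (ball (0 : EuclideanSpace ℝ (Fin 3)) (3 * R * Real.sqrt (-tb)) ⊆ ball (Real.sqrt (-tb) • y₀) ((rT * Real.sqrt (-tb)) / 2)) ∧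
        (∀ s ∈ Icc (tauS29 Cu K * (-tb)) (2 * (tauS29 Cu K * (-tb))), ∀ x ∈ ball (0 : EuclideanSpace ℝ (Fin 3)) (3 * R * Real.sqrt (-tb)),
            ‖x - (Real.sqrt (-tb) • y₀)‖ ^ 2 / (4 * s) ≤ ((‖y₀‖ + 3 * R) ^ 2 / (4 * tauS29 Cu K))) ∧
        ContinuousOn (uncurry fun s x => curl (u (tb - s)) x)
          (Icc (tauS29 Cu K * (-tb)) (2 * (tauS29 Cu K * (-tb))) ×ˢ closedBall (0 : EuclideanSpace ℝ (Fin 3)) (4 * R * Real.sqrt (-tb)))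

/-- **Stub B4 (T)** — Chebyshev in `s ∈ [t₀, 2t₀]`, `t₀ = τ(−t̄)`, and pull-back to the door's conclusion at `t' = t̄ − s`. -/
def ChebyshevPullbackS29 : Prop :=
  ∀ (u : ℝ → EuclideanSpace ℝ (Fin 3) → EuclideanSpace ℝ (Fin 3)) (tb τ θ R : ℝ), tb < 0 → 0 < τ → τ ≤ 1 / 8000 → 0 < θ → 0 < R →
    ContinuousOn (uncurry fun s x => curl (u (tb - s)) x)
      (Icc (τ * (-tb)) (2 * (τ * (-tb))) ×ˢ closedBall (0 : EuclideanSpace ℝ (Fin 3)) (4 * R * Real.sqrt (-tb))) →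
    Jcore (fun s x => curl (u (tb - s)) x) (3 * R * Real.sqrt (-tb)) (τ * (-tb)) ≤
      (τ * (-tb)) * (θ ^ 2 / (5 * Real.sqrt (-tb))) →
    ∃ t' ∈ Icc ((1 + 2 * τ) * tb) ((1 + τ) * tb),
      ∫⁻ x in ball (0 : EuclideanSpace ℝ (Fin 3)) (2 * R * Real.sqrt (-t')), ENNReal.ofReal (‖curl (u t') x‖ ^ 2) ≤
        ENNReal.ofReal (θ ^ 2 / (4 * Real.sqrt (-t')))

/-! ## §3 The composition (kernel-checked) -/

/-- `0 < T_c(C_u, K)` for positive data. -/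
theorem tcS29_pos {Cu K : ℝ} (hCu : 0 < Cu) (hK : 0 < K) : 0 < tcS29 Cu K := by
  unfold tcS29
  exact lt_min one_pos (lt_min (by positivity) (by positivity))

/-- `T_c ≤ 1`. -/
theorem tcS29_le_one (Cu K : ℝ) : tcS29 Cu K ≤ 1 := min_le_left _ _

/-- the package lateness is positive. -/
theorem t1S29pkg_pos {c₁ d R rT : ℝ} (hc₁ : 0 < c₁) (hd : 0 ≤ d) (hR : 2 ≤ R) (hrT : 0 ≤ rT) :
    0 < t1S29pkg c₁ d R rT := by
  unfold t1S29pkg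
  have hm : 0 < min c₁ 1 := lt_min hc₁ one_pos
  have : 0 < d + 3 * R + rT + 4 := by linarith
  exact lt_min (by norm_num) (by positivity)

/-- **FILE 2 = the six stubs**; this composition is plumbing only (no analysis): the six texts enter as hypotheses
(Tao's inequality at physical scale, lower bound B1, upper bounds B2, scalar budget B3 at the slice, Chebyshev B4). -/
theorem peepholeToCore_of_stubs (hA : RegionCarlemanVorticityS29) (hB1 : CoreLowerS29) (hB2 : UpperXYS29)
    (hB3 : CarlemanBudgetS29) (hD : CylinderPackageS29) (hB4 : ChebyshevPullbackS29) :
    PeepholeToCore := by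
  intro Cu hCu θ hθ R hR K K₂ hK hK₂ y₀ rp hrp
  obtain ⟨Kt, hKt, hA⟩ := hA
  have hTc : 0 < tcS29 Cu K := tcS29_pos hCu hK
  have hTc1 : tcS29 Cu K ≤ 1 := tcS29_le_one Cu K
  have hτ : 0 < tauS29 Cu K := by unfold tauS29; positivity
  obtain ⟨rT, S, ε, hrT, hrT2, hS, hε, hbig⟩ :=
    hB3 Kt hKt (tcS29 Cu K) (tauS29 Cu K) θ R K K₂ ‖y₀‖ rp hTc hτ hθ hR hK hK₂ (norm_nonneg _) hrp
  have hτle : tauS29 Cu K ≤ 1 / 8000 := by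
    unfold tauS29; linarith
  have hd0 : 0 ≤ ‖y₀‖ := norm_nonneg _
  have hrT0 : 0 < rT := by linarith
  refine ⟨ε, hε, tauS29 Cu K, hτ, fun c₁ hc₁ => ⟨t1S29pkg c₁ ‖y₀‖ R rT,
    t1S29pkg_pos hc₁ (norm_nonneg _) hR hrT0.le, (min_le_left _ _).trans (by norm_num), ?_⟩⟩
  intro u p hsol h115 hg1 hg2 tb htb hpeep
  have htb0 : tb < 0 := htb.2
  have hntb : 0 < -tb := by linarith
  have hℓ : 0 < Real.sqrt (-tb) := Real.sqrt_pos.2 hntb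
  have hℓ2 : Real.sqrt (-tb) ^ 2 = -tb := Real.sq_sqrt hntb.le
  obtain ⟨h1, h2, h3, h4, h5, h6, h7, h8, h9, h10⟩ :=
    hD Cu R K K₂ y₀ rp c₁ rT ε hCu hR hK hK₂ hrp hc₁ hrT hε.le u p hsol h115 hg1 hg2 tb htb hpeep
  -- the Carleman inequality at physical scale
  have hTp : 0 < tcS29 Cu K * (-tb) := mul_pos hTc hntb
  have hr : 0 < rT * Real.sqrt (-tb) := mul_pos hrT0 hℓ
  have hrρ : rT * Real.sqrt (-tb) < rT * Real.sqrt (-tb) + Real.sqrt (-tb) := lt_add_of_pos_right _ hℓ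
  have h4000 : 4000 * (tcS29 Cu K * (-tb)) ≤ (rT * Real.sqrt (-tb)) ^ 2 := by
    rw [mul_pow, hℓ2]; nlinarith
  have ht0 : 0 < tauS29 Cu K * (-tb) := mul_pos hτ hntb
  have ht1 : 0 < tauS29 Cu K * (-tb) * Real.exp (-S) := mul_pos ht0 (Real.exp_pos _)
  have ht10 : tauS29 Cu K * (-tb) * Real.exp (-S) ≤ tauS29 Cu K * (-tb) :=
    mul_le_of_le_one_right ht0.le (Real.exp_le_one_iff.2 (by linarith))
  have h8000 : 8000 * (tauS29 Cu K * (-tb)) ≤ tcS29 Cu K * (-tb) := by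
    unfold tauS29; apply le_of_eq; ring
  have hcar := hA hsol hTp h1 htb0 (Real.sqrt (-tb) • y₀) hr hrρ h2 h4000 ht1 ht10 h8000 h3
  -- lower and upper bounds
  have h2t0 : 2 * (tauS29 Cu K * (-tb)) ≤ tcS29 Cu K * (-tb) := by linarith
  have hlow := hB1 (fun s x => curl (u (tb - s)) x) (Real.sqrt (-tb) • y₀) (3 * R * Real.sqrt (-tb))
    (tcS29 Cu K * (-tb)) (rT * Real.sqrt (-tb)) (tauS29 Cu K * (-tb)) ((‖y₀‖ + 3 * R) ^ 2 / (4 * tauS29 Cu K))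
    hTp ht0 h2t0 h4 h5 h8 h9
  have hM1 : 0 ≤ 6 * K / (-tb) := by positivity
  have hM2 : 0 ≤ 6 * K₂ / ((-tb) * Real.sqrt (-tb)) := by positivity
  have hε' : 0 ≤ ε / (-tb) := by positivity
  have hrp' : 0 < rp * Real.sqrt (-tb) := mul_pos hrp hℓ
  obtain ⟨hX, hY⟩ := hB2 (fun s y => curl (u (tb - s)) ((Real.sqrt (-tb) • y₀) + y)) (tcS29 Cu K * (-tb)) (rT * Real.sqrt (-tb))
    (tauS29 Cu K * (-tb) * Real.exp (-S)) (6 * K / (-tb)) (6 * K₂ / ((-tb) * Real.sqrt (-tb))) (ε / (-tb))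
    (rp * Real.sqrt (-tb)) hTp hr ht1 hM1 hM2 hε' hrp' h4 h5 h6 h7
  -- chain the three inequalities
  have hchain : (tcS29 Cu K * (-tb))⁻¹ * Real.exp (-((‖y₀‖ + 3 * R) ^ 2 / (4 * tauS29 Cu K))) * Jcore (fun s x => curl (u (tb - s)) x) (3 * R * Real.sqrt (-tb)) (tauS29 Cu K * (-tb)) ≤
      (Kt * (Real.exp (-(rT * Real.sqrt (-tb)) ^ 2 / (500 * (tauS29 Cu K * (-tb)))) * ((tcS29 Cu K * (-tb)) * (vB * (rT * Real.sqrt (-tb)) ^ 3) * ((tcS29 Cu K * (-tb))⁻¹ * (6 * K / (-tb)) ^ 2 + (6 * K₂ / ((-tb) * Real.sqrt (-tb))) ^ 2)) + (tauS29 Cu K * (-tb)) ^ ((3 : ℝ) / 2) * Real.exp (Kt * ((rT * Real.sqrt (-tb)) ^ 2 / (tauS29 Cu K * (-tb))) * Real.log (Real.exp 1 * (tauS29 Cu K * (-tb)) / (tauS29 Cu K * (-tb) * Real.exp (-S)))) * ((ε / (-tb)) ^ 2 * (4 * Real.pi) ^ ((3 : ℝ) / 2) + (6 * K / (-tb)) ^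 2 * (vB * (rT * Real.sqrt (-tb)) ^ 3) * ((tauS29 Cu K * (-tb) * Real.exp (-S)) ^ (-(3 : ℝ) / 2) * Real.exp (-(rp * Real.sqrt (-tb)) ^ 2 / (4 * (tauS29 Cu K * (-tb) * Real.exp (-S)))))))) := by
    refine hlow.trans (hcar.trans ?_)
    apply mul_le_mul_of_nonneg_left _ hKt.le
    apply add_le_add
    · exact mul_le_mul_of_nonneg_left hX (Real.exp_pos _).le
    · apply mul_le_mul_of_nonneg_left hY
      exact mul_nonneg (Real.rpow_nonneg ht0.le _) (Real.exp_pos _).le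
  have hJ : Jcore (fun s x => curl (u (tb - s)) x) (3 * R * Real.sqrt (-tb)) (tauS29 Cu K * (-tb)) ≤
      (tcS29 Cu K * (-tb)) * Real.exp ((‖y₀‖ + 3 * R) ^ 2 / (4 * tauS29 Cu K)) *
          (Kt * (Real.exp (-(rT * Real.sqrt (-tb)) ^ 2 / (500 * (tauS29 Cu K * (-tb)))) * ((tcS29 Cu K * (-tb)) * (vB * (rT * Real.sqrt (-tb)) ^ 3) * ((tcS29 Cu K * (-tb))⁻¹ * (6 * K / (-tb)) ^ 2 + (6 * K₂ / ((-tb) * Real.sqrt (-tb))) ^ 2)) + (tauS29 Cu K * (-tb)) ^ ((3 : ℝ) / 2) * Real.exp (Kt * ((rT * Real.sqrt (-tb)) ^ 2 / (tauS29 Cu K * (-tb))) * Real.log (Real.exp 1 * (tauS29 Cu K * (-tb)) / (tauS29 Cu K * (-tb) * Real.exp (-S)))) * ((ε / (-tb)) ^ 2 * (4 * Real.pi) ^ ((3 : ℝ) / 2) + (6 * K / (-tb)) ^ 2 * (vB * (rT * Real.sqrt (-tb)) ^ 3) * ((tauS29 Cu K * (-tb) * Real.exp (-S)) ^ (-(3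 : ℝ) / 2) * Real.exp (-(rp * Real.sqrt (-tb)) ^ 2 / (4 * (tauS29 Cu K * (-tb) * Real.exp (-S)))))))) := by
    have hpos : 0 < (tcS29 Cu K * (-tb)) * Real.exp ((‖y₀‖ + 3 * R) ^ 2 / (4 * tauS29 Cu K)) := mul_pos hTp (Real.exp_pos _)
    have hmul := mul_le_mul_of_nonneg_left hchain hpos.le
    have hcancel : (tcS29 Cu K * (-tb)) * Real.exp ((‖y₀‖ + 3 * R) ^ 2 / (4 * tauS29 Cu K)) *
        ((tcS29 Cu K * (-tb))⁻¹ * Real.exp (-((‖y₀‖ + 3 * R) ^ 2 / (4 * tauS29 Cu K))) * Jcore (fun s x => curl (u (tb - s)) x) (3 * R * Real.sqrt (-tb)) (tauS29 Cu K * (-tb))) = Jcore (fun s x => curl (u (tb - s)) x) (3 * R * Real.sqrt (-tb)) (tauS29 Cu K * (-tb)) := by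
      rw [Real.exp_neg]
      have hTp' : (tcS29 Cu K * (-tb)) ≠ 0 := hTp.ne'
      have hE : Real.exp ((‖y₀‖ + 3 * R) ^ 2 / (4 * tauS29 Cu K)) ≠ 0 := (Real.exp_pos _).ne'
      calc (tcS29 Cu K * (-tb)) * Real.exp ((‖y₀‖ + 3 * R) ^ 2 / (4 * tauS29 Cu K)) *
            ((tcS29 Cu K * (-tb))⁻¹ * (Real.exp ((‖y₀‖ + 3 * R) ^ 2 / (4 * tauS29 Cu K)))⁻¹ * Jcore (fun s x => curl (u (tb - s)) x) (3 * R * Real.sqrt (-tb)) (tauS29 Cu K * (-tb)))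
          = ((tcS29 Cu K * (-tb)) * (tcS29 Cu K * (-tb))⁻¹) * (Real.exp ((‖y₀‖ + 3 * R) ^ 2 / (4 * tauS29 Cu K)) * (Real.exp ((‖y₀‖ + 3 * R) ^ 2 / (4 * tauS29 Cu K)))⁻¹) *
              Jcore (fun s x => curl (u (tb - s)) x) (3 * R * Real.sqrt (-tb)) (tauS29 Cu K * (-tb)) := by ring
        _ = Jcore (fun s x => curl (u (tb - s)) x) (3 * R * Real.sqrt (-tb)) (tauS29 Cu K * (-tb)) := by rw [mul_inv_cancel₀ hTp', mul_inv_cancel₀ hE, one_mul, one_mul]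
    rw [hcancel] at hmul
    exact hmul
  have hfin : Jcore (fun s x => curl (u (tb - s)) x) (3 * R * Real.sqrt (-tb)) (tauS29 Cu K * (-tb)) ≤ (tauS29 Cu K * (-tb)) * (θ ^ 2 / (5 * Real.sqrt (-tb))) :=
    hJ.trans (hbig tb htb0)
  exact hB4 u tb (tauS29 Cu K) θ R htb0 hτ hτle hθ (by linarith) h10 hfin

end Summit.NavierStokesRegularity.NavierStokesRegularity.Theorems.PeepholeVorticityDoor

end
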